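import Literature.NumberTheory.GelbartRogawski1991.LocalDoubledUnitaryIwahori
import Literature.RepresentationTheory.HeisenbergGroup.ImplementerOmegaEigen
import Literature.NumberTheory.Automorphic.ReductiveGroupData
import HarnessLib

-- buildfix G11b-3 recipe (LEDGER B13-1/B13-3): elaborate sequentially so the trailing `attribute [implicit_reducible]`
-- block (reducibilityCoreExt is keyed to the async environment branch) is in force at `.olean` export.
set_option Elab.async false

/-!
# The unramified clause for the doubled unitary group, I: the integral big-cell argument inside `H(𝒪_v)`

[cite: GelbartRogawski1991, §3.1 (3.1.3) p. 456; MoeglinVignerasWaldspurger1987, Chap. 2 II.10; Kudla1994, §3]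

At a non-split place `v ∤ 2` of good reduction, let `K_H = H(𝒪_v)` (`UnitaryGroup.localInt`) and `ω = β⁻¹ · r ∘ ι` the
genuine local Weil representation of `H(F_v)` (`ImplementerOmega`). We prove the GROUP-THEORETIC HEART of the unramified
clause "`K_H` fixes the unramified vector `Φ₀`": IF
* `Φ₀ ≠ 0` is an eigenvector of `ω(w_Δ)` (one element!),
* every `p ∈ P_Δ ∩ K_H` fixes `Φ₀` (the parabolic part: `χ_v` unramified and the explicit parabolic operators), and
* every `k ∈ K_H` admits an INTEGRAL RESIDUE WITNESS: an integral `T₀`-skew `y` with `det (A_k + y C_k) ∈ 𝒪_w^×`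
  (adapted blocks; this is the big cell of the reduction mod `𝔭`),
THEN every `k ∈ K_H` fixes `Φ₀` (`omega_eq_self_of_residueWitness`). Indeed `w_Δ n(y) k = p · (w_Δ n(−ν))` inside
`K_H` with `p ∈ P_Δ ∩ K_H`, `ν = −(A_k + yC_k)⁻¹ (B_k + yD_k)` integral and skew (§2, the integral Levi-type
decomposition of the big cell), and then `ω(k)Φ₀ = Φ₀` by pure group theory (§3: `k = n(y)⁻¹ w⁻¹ p w n(−ν)`,
`ω(w)⁻¹Φ₀ = s⁻¹Φ₀`). No value of `β` off `P_Δ`, no cocycle value, and no generation statement for `K_H` is used.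

* §1 the elements `n(t) ∈ P_Δ` for integral skew `t`, their `w`-components, integrality (`|2|_w = 1`);
* §2 the decomposition; §3 the conclusion.
-/

set_option autoImplicit false

noncomputable section

open NumberField IsDedekindDomain Matrix
open scoped ValuativeRel
open Literature.NumberTheory.Automorphic Literature.NumberTheory.Automorphic.UnitaryGroup
open Literature.NumberTheory.GelbartRogawski1991.AdaptedBlocks
open Literature.RepresentationTheory.HeisenbergGroup

namespace Literature.NumberTheory.GelbartRogawski1991.UnitaryDualPair.LocalSplitting

variable (F : Type) [Field F] [NumberField F] (E : Type) [Field E] [NumberField E] [Algebra F E]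
  [Algebra.IsQuadraticExtension F E] (c : E ≃ₐ[F] E)
  {δ : E} (hcδ : c δ = -δ) (hδ : δ ≠ 0) {d : F} (hd : δ * δ = algebraMap F E d)
  (v : HeightOneSpectrum (𝓞 F)) (n : ℕ) {T₀ : Matrix (Fin n) (Fin n) F} (hT₀ : T₀.IsSymm) (hT₀d : IsUnit T₀.det)
  {JD : Matrix (Fin (n + n)) (Fin (n + n)) E} (hJD : JD = (gramD F n T₀).map (algebraMap F E))

/-! ## §0 Integral matrices over `E ⊗ F_v` at the place `w` -/

/-- **`M` is integral at `w`**: all `w`-entries lie in `𝒪_w`. [cite: GelbartRogawski1991, §3.1 (3.1.3)] -/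
def IsIntegralAt {m : Type*} (w : PlacesOver E v) (M : Matrix m m (LocalRing E v)) : Prop :=
  ValBound 1 (M.map (Pi.evalRingHom (fun w' : PlacesOver E v => w'.1.adicCompletion E) w))

omit [NumberField F] [Algebra.IsQuadraticExtension F E] in
/-- unfolding. [cite: GelbartRogawski1991, §3.1 (3.1.3)] -/
theorem isIntegralAt_iff {m : Type*} (w : PlacesOver E v) (M : Matrix m m (LocalRing E v)) :
    IsIntegralAt F E v w M ↔ ∀ i j, ValuativeRel.valuation (w.1.adicCompletion E) (M i j w) ≤ 1 := Iff.rfl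

namespace IsIntegralAt

variable {F E v} {m : Type*} {w : PlacesOver E v}

omit [NumberField F] [Algebra.IsQuadraticExtension F E] in
/-- products of integral matrices are integral. [cite: GelbartRogawski1991, §3.1 (3.1.3)] -/
theorem mul [Fintype m] {M N : Matrix m m (LocalRing E v)} (hM : IsIntegralAt F E v w M) (hN : IsIntegralAt F E v w N) :
    IsIntegralAt F E v w (M * N) := by
  have h := ValBound.mul hM hN
  rw [one_mul, ← Matrix.map_mul] at h
  exact h

omit [NumberField F] [Algebra.IsQuadraticExtension F E] in
/-- sums. [cite: GelbartRogawski1991, §3.1 (3.1.3)] -/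
theorem add {M N : Matrix m m (LocalRing E v)} (hM : IsIntegralAt F E v w M) (hN : IsIntegralAt F E v w N) :
    IsIntegralAt F E v w (M + N) := by
  have h := ValBound.add hM hN
  rw [← Matrix.map_add _ (map_add _)] at h
  exact h

omit [NumberField F] [Algebra.IsQuadraticExtension F E] in
/-- negatives. [cite: GelbartRogawski1991, §3.1 (3.1.3)] -/
theorem neg {M : Matrix m m (LocalRing E v)} (hM : IsIntegralAt F E v w M) : IsIntegralAt F E v w (-M) := by
  intro i j
  have := hM i j
  simp only [Matrix.map_apply, Matrix.neg_apply, map_neg, Valuation.map_neg] at this ⊢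
  exact this

omit [NumberField F] [Algebra.IsQuadraticExtension F E] in
/-- `0` is integral. [cite: GelbartRogawski1991, §3.1 (3.1.3)] -/
theorem zero : IsIntegralAt F E v w (0 : Matrix m m (LocalRing E v)) := fun i j => by simp

omit [NumberField F] [Algebra.IsQuadraticExtension F E] in
/-- `1` is integral. [cite: GelbartRogawski1991, §3.1 (3.1.3)] -/
theorem one [DecidableEq m] : IsIntegralAt F E v w (1 : Matrix m m (LocalRing E v)) := by
  intro i j
  rw [Matrix.map_one _ (map_zero _) (map_one _)]
  exact valBound_one i j

omit [NumberField F] [Algebra.IsQuadraticExtension F E] in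
/-- block matrices. [cite: GelbartRogawski1991, §3.1 (3.1.3)] -/
theorem fromBlocks {l : Type*} {A : Matrix l l (LocalRing E v)} {B : Matrix l m (LocalRing E v)} {C : Matrix m l (LocalRing E v)}
    {D : Matrix m m (LocalRing E v)}
    (hA : ValBound 1 (A.map (Pi.evalRingHom (fun w' : PlacesOver E v => w'.1.adicCompletion E) w)))
    (hB : ∀ i j, ValuativeRel.valuation (w.1.adicCompletion E) (B i j w) ≤ 1)
    (hC : ∀ i j, ValuativeRel.valuation (w.1.adicCompletion E) (C i j w) ≤ 1)
    (hD : ValBound 1 (D.map (Pi.evalRingHom (fun w' : PlacesOver E v => w'.1.adicCompletion E) w))) :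
    IsIntegralAt F E v w (Matrix.fromBlocks A B C D) := by
  rintro (i | i) (j | j)
  · exact hA i j
  · exact hB i j
  · exact hC i j
  · exact hD i j

omit [NumberField F] [Algebra.IsQuadraticExtension F E] in
/-- the blocks of an integral matrix are integral. [cite: GelbartRogawski1991, §3.1 (3.1.3)] -/
theorem toBlocks {l : Type*} {M : Matrix (l ⊕ m) (l ⊕ m) (LocalRing E v)} (hM : IsIntegralAt F E v w M) :
    IsIntegralAt F E v w M.toBlocks₁₁ ∧ IsIntegralAt F E v w M.toBlocks₂₂ ∧
      (∀ i j, ValuativeRel.valuation (w.1.adicCompletion E) (M.toBlocks₁₂ i j w) ≤ 1) ∧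
      (∀ i j, ValuativeRel.valuation (w.1.adicCompletion E) (M.toBlocks₂₁ i j w) ≤ 1) :=
  ⟨fun i j => hM (Sum.inl i) (Sum.inl j), fun i j => hM (Sum.inr i) (Sum.inr j),
    fun i j => hM (Sum.inl i) (Sum.inr j), fun i j => hM (Sum.inr i) (Sum.inl j)⟩

omit [NumberField F] [Algebra.IsQuadraticExtension F E] in
/-- re-enumeration preserves integrality. [cite: GelbartRogawski1991, §3.1 (3.1.3)] -/
theorem submatrix {l : Type*} {M : Matrix m m (LocalRing E v)} (hM : IsIntegralAt F E v w M) (e f : l → m) :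
    IsIntegralAt F E v w (M.submatrix e f) := fun i j => hM (e i) (f j)

omit [NumberField F] [Algebra.IsQuadraticExtension F E] in
/-- scalar multiples by an integral scalar. [cite: GelbartRogawski1991, §3.1 (3.1.3)] -/
theorem smul {M : Matrix m m (LocalRing E v)} (hM : IsIntegralAt F E v w M) {a : LocalRing E v}
    (ha : ValuativeRel.valuation (w.1.adicCompletion E) (a w) ≤ 1) : IsIntegralAt F E v w (a • M) := by
  intro i j
  have := hM i j
  simp only [Matrix.map_apply, Matrix.smul_apply, smul_eq_mul, Pi.evalRingHom_apply, _root_.map_mul] at this ⊢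
  exact mul_le_one' ha this

end IsIntegralAt

/-! ## §1 Integrality in the adapted frame: `R`, `R⁻¹`, `adapt` at a place `v ∤ 2` -/

omit [NumberField F] [Algebra.IsQuadraticExtension F E] in
/-- `R` is integral. [cite: HarrisKudlaSweet1996, §1 (1.11)] -/
theorem isIntegralAt_cayR (w : PlacesOver E v) : IsIntegralAt F E v w (cayR (LocalRing E v) (Fin n)) := by
  refine IsIntegralAt.fromBlocks (IsIntegralAt.one (w := w)) (fun i j => ?_) (fun i j => ?_) (IsIntegralAt.neg IsIntegralAt.one)
  all_goals
    by_cases h : i = j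
    · subst h; simp
    · simp [Matrix.one_apply_ne h]

omit [Algebra.IsQuadraticExtension F E] in
/-- `R⁻¹ = ½ R` is integral when `|2|_w = 1`. [cite: HarrisKudlaSweet1996, §1 (1.11)] -/
theorem isIntegralAt_cayRinv (w : PlacesOver E v) (h2 : ValuativeRel.valuation (w.1.adicCompletion E) 2 = 1) :
    IsIntegralAt F E v w (cayRinv (LocalRing E v) (Fin n)) := by
  rw [cayRinv]
  refine (isIntegralAt_cayR F E v n w).smul (le_of_eq ?_)
  have h : (⅟(2 : LocalRing E v)) w * 2 = 1 := by
    have := congrFun (invOf_mul_self (2 : LocalRing E v)) w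
    simpa using this
  have := congrArg (ValuativeRel.valuation (w.1.adicCompletion E)) h
  rw [_root_.map_mul, h2, mul_one, _root_.map_one] at this
  exact this

omit [Algebra.IsQuadraticExtension F E] in
/-- `adapt M = R⁻¹ M R` is integral if `M` is (and `|2|_w = 1`). [cite: HarrisKudlaSweet1996, §1 (1.11)] -/
theorem isIntegralAt_adapt (w : PlacesOver E v) (h2 : ValuativeRel.valuation (w.1.adicCompletion E) 2 = 1)
    {M : Matrix (Fin n ⊕ Fin n) (Fin n ⊕ Fin n) (LocalRing E v)} (hM : IsIntegralAt F E v w M) : IsIntegralAt F E v w (adapt M) :=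
  ((isIntegralAt_cayRinv F E v n w h2).mul hM).mul (isIntegralAt_cayR F E v n w)

omit [Algebra.IsQuadraticExtension F E] in
/-- `R Y R⁻¹` is integral if `Y` is (and `|2|_w = 1`). [cite: HarrisKudlaSweet1996, §1 (1.11)] -/
theorem isIntegralAt_conj (w : PlacesOver E v) (h2 : ValuativeRel.valuation (w.1.adicCompletion E) 2 = 1)
    {Y : Matrix (Fin n ⊕ Fin n) (Fin n ⊕ Fin n) (LocalRing E v)} (hY : IsIntegralAt F E v w Y) :
    IsIntegralAt F E v w (cayR (LocalRing E v) (Fin n) * Y * cayRinv (LocalRing E v) (Fin n)) :=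
  ((isIntegralAt_cayR F E v n w).mul hY).mul (isIntegralAt_cayRinv F E v n w h2)

/-! ## §2 `K_H = H(𝒪_v)` at a non-split place and the elements `n(t)`, `w_Δ` -/

include hcδ hδ in
/-- at a non-split place, `k ∈ H(𝒪_v)` iff its `w`-component is in `GL_{n+n}(𝒪_w)`. [cite: PlatonovRapinchuk1994, §5.1] -/
theorem mem_localInt_iff_w (w : PlacesOver E v) (hw : c • w.1 = w.1) (k : UnitaryGroup.localPi E c (n + n) JD v) :
    k ∈ UnitaryGroup.localInt E c (n + n) JD v ↔ (k : UnitaryGroup.LocalGLPi E (n + n) v) w ∈ glInt (n + n) (w.1.adicCompletion E) := by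
  rw [mem_localInt_iff]
  refine ⟨fun h => h w, fun h w' => ?_⟩
  rw [PlacesOver.eq_of_smul_eq c (galConj_ne_one_of_delta F E c hcδ hδ) w hw w']
  exact h

omit [Algebra.IsQuadraticExtension F E] in
/-- **integrality of the matrix over `E ⊗ F_v` gives membership in `GL(𝒪_w)` of the `w`-component** (together with
integrality of the inverse). [cite: PlatonovRapinchuk1994, §5.1] -/
theorem apply_mem_glInt_of_isIntegralAt (w : PlacesOver E v) (k : UnitaryGroup.localPi E c (n + n) JD v)
    (hk : IsIntegralAt F E v w (matA F E c v n k)) (hk' : IsIntegralAt F E v w (matA F E c v n k⁻¹)) :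
    (k : UnitaryGroup.LocalGLPi E (n + n) v) w ∈ glInt (n + n) (w.1.adicCompletion E) := by
  rw [mem_glInt_iff]
  have e : ∀ g : UnitaryGroup.localPi E c (n + n) JD v,
      (((g : UnitaryGroup.LocalGLPi E (n + n) v) w : GL (Fin (n + n)) (w.1.adicCompletion E)) :
        Matrix (Fin (n + n)) (Fin (n + n)) (w.1.adicCompletion E)) =
        ((matA F E c v n g).submatrix (e₂ n).symm (e₂ n).symm).map (Pi.evalRingHom _ w) := by
    intro g
    rw [coe_component_eq_matS_map, ← reindex_matA, Matrix.reindex_apply]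
  constructor
  · intro i j
    rw [e, Valuation.mem_integer_iff]
    exact hk.submatrix _ _ i j
  · intro i j
    have hinv : ((k : UnitaryGroup.LocalGLPi E (n + n) v) w)⁻¹ =
        ((k⁻¹ : UnitaryGroup.localPi E c (n + n) JD v) : UnitaryGroup.LocalGLPi E (n + n) v) w := by
      rw [Subgroup.coe_inv, Pi.inv_apply]
    rw [hinv, e, Valuation.mem_integer_iff]
    exact hk'.submatrix _ _ i j


include hcδ hδ in
/-- the matrix over `E ⊗ F_v` of an element of `H(𝒪_v)` is integral at `w` (non-split `v`). [cite: PlatonovRapinchuk1994, §5.1] -/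
theorem isIntegralAt_matA_of_mem_localInt (w : PlacesOver E v) (hw : c • w.1 = w.1) {k : UnitaryGroup.localPi E c (n + n) JD v}
    (hk : k ∈ UnitaryGroup.localInt E c (n + n) JD v) : IsIntegralAt F E v w (matA F E c v n k) := by
  have h := ((mem_glInt_iff _).1 ((mem_localInt_iff_w F E c hcδ hδ v n w hw k).1 hk)).1
  intro i j
  have hij := h (e₂ n i) (e₂ n j)
  rw [coe_component_eq_matS_map, Valuation.mem_integer_iff] at hij
  simpa only [matA, Matrix.map_apply, Matrix.reindex_apply, Equiv.symm_symm, Matrix.submatrix_apply] using hij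

omit [Algebra.IsQuadraticExtension F E] in
include hT₀d in
/-- `det (T₀ ⊗ 1)` is a unit over `E ⊗ F_v`. [cite: HarrisKudlaSweet1996, §1 (1.9)] -/
theorem isUnit_det_gramS' : IsUnit (gramS F E v n T₀).det := by
  rw [gramS, ← RingHom.mapMatrix_apply, ← RingHom.mapMatrix_apply, ← RingHom.map_det, ← RingHom.map_det]
  exact (hT₀d.map _).map _

omit [Algebra.IsQuadraticExtension F E] in
/-- skewness is preserved by negation. [cite: Weil1964, n° 32] -/
theorem skew_neg {t : Matrix (Fin n) (Fin n) (LocalRing E v)}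
    (ht : (t.map (conjLocal E c v))ᵀ * gramS F E v n T₀ + gramS F E v n T₀ * t = 0) :
    ((-t).map (conjLocal E c v))ᵀ * gramS F E v n T₀ + gramS F E v n T₀ * (-t) = 0 := by
  have e : (-t).map (conjLocal E c v) = -(t.map (conjLocal E c v)) := by ext i j; simp
  rw [e, Matrix.transpose_neg, Matrix.neg_mul, Matrix.mul_neg, ← neg_add, ht, neg_zero]

include hJD in
/-- **the element `n(t) ∈ P_Δ(F_v)`**: adapted matrix `[[1, t], [0, 1]]`, for a `T₀`-skew `t`. [cite: Kudla1994, §3; Weil1964, n° 32] -/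
def nElem (t : Matrix (Fin n) (Fin n) (LocalRing E v))
    (ht : (t.map (conjLocal E c v))ᵀ * gramS F E v n T₀ + gramS F E v n T₀ * t = 0) : UnitaryGroup.localPi E c (n + n) JD v :=
  ofAdapted F E c v n hJD (Matrix.fromBlocks 1 t 0 1)
    (by rw [Matrix.det_fromBlocks_zero₂₁, Matrix.det_one, mul_one]; exact isUnit_one)
    (cstar_upperUnip_of_skew (conjLocal E c v) _ (cstar_skew_two_smul ht))

omit [Algebra.IsQuadraticExtension F E] in
include hJD in
/-- `adapt (matA (n(t))) = [[1, t], [0, 1]]`. [cite: Kudla1994, §3] -/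
theorem adapt_matA_nElem (t : Matrix (Fin n) (Fin n) (LocalRing E v))
    (ht : (t.map (conjLocal E c v))ᵀ * gramS F E v n T₀ + gramS F E v n T₀ * t = 0) :
    adapt (matA F E c v n (nElem F E c v n hJD t ht)) = Matrix.fromBlocks 1 t 0 1 :=
  adapt_matA_ofAdapted F E c v n hJD _ _ _

include hcδ hδ hd hT₀ hJD in
/-- `n(t) ∈ P_Δ(F_v)`. [cite: Kudla1994, §3] -/
theorem isSiegelDelta_nElem (t : Matrix (Fin n) (Fin n) (LocalRing E v))
    (ht : (t.map (conjLocal E c v))ᵀ * gramS F E v n T₀ + gramS F E v n T₀ * t = 0) :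
    IsSiegelDelta F E c hcδ hδ hd v n hT₀ hJD (nElem F E c v n hJD t ht) :=
  isSiegelDelta_ofAdapted_fromBlocks F E c hcδ hδ hd v n hT₀ hJD _ _ _ _ _

omit [Algebra.IsQuadraticExtension F E] in
include hJD in
/-- `n(t) n(−t) = 1`. [cite: Kudla1994, §3] -/
theorem nElem_mul_nElem_neg (t : Matrix (Fin n) (Fin n) (LocalRing E v))
    (ht : (t.map (conjLocal E c v))ᵀ * gramS F E v n T₀ + gramS F E v n T₀ * t = 0) :
    nElem F E c v n hJD t ht * nElem F E c v n hJD (-t) (skew_neg F E c v n ht) = 1 := by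
  apply matA_injective F E c v n
  rw [← matA_mul, matA_one, nElem, nElem, matA_ofAdapted, matA_ofAdapted]
  calc cayR _ _ * Matrix.fromBlocks 1 t 0 1 * cayRinv _ _ * (cayR _ _ * Matrix.fromBlocks 1 (-t) 0 1 * cayRinv _ _)
      = cayR (LocalRing E v) (Fin n) * (Matrix.fromBlocks 1 t 0 1 * (cayRinv _ _ * cayR _ _) * Matrix.fromBlocks 1 (-t) 0 1) *
          cayRinv (LocalRing E v) (Fin n) := by simp only [Matrix.mul_assoc]
    _ = 1 := by
      rw [cayRinv_mul_cayR, Matrix.mul_one, Matrix.fromBlocks_multiply]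
      simp only [Matrix.one_mul, Matrix.mul_one, Matrix.zero_mul, Matrix.mul_zero, add_zero, zero_add, Matrix.mul_neg,
        neg_zero, neg_add_cancel]
      rw [Matrix.fromBlocks_one, Matrix.mul_one, cayR_mul_cayRinv]

omit [Algebra.IsQuadraticExtension F E] in
include hJD in
/-- `n(t)⁻¹ = n(−t)`. [cite: Kudla1994, §3] -/
theorem nElem_inv (t : Matrix (Fin n) (Fin n) (LocalRing E v))
    (ht : (t.map (conjLocal E c v))ᵀ * gramS F E v n T₀ + gramS F E v n T₀ * t = 0) :
    (nElem F E c v n hJD t ht)⁻¹ = nElem F E c v n hJD (-t) (skew_neg F E c v n ht) :=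
  inv_eq_of_mul_eq_one_right (nElem_mul_nElem_neg F E c v n hJD t ht)

omit [Algebra.IsQuadraticExtension F E] in
include hJD in
/-- the matrix of `n(t)` is integral if `t` is (`|2|_w = 1`). [cite: GelbartRogawski1991, §3.1 (3.1.3)] -/
theorem isIntegralAt_matA_nElem (w : PlacesOver E v) (h2 : ValuativeRel.valuation (w.1.adicCompletion E) 2 = 1)
    {t : Matrix (Fin n) (Fin n) (LocalRing E v)} (ht : (t.map (conjLocal E c v))ᵀ * gramS F E v n T₀ + gramS F E v n T₀ * t = 0)
    (hti : IsIntegralAt F E v w t) : IsIntegralAt F E v w (matA F E c v n (nElem F E c v n hJD t ht)) := by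
  rw [nElem, matA_ofAdapted]
  exact isIntegralAt_conj F E v n w h2 (IsIntegralAt.fromBlocks IsIntegralAt.one hti (fun i j => by simp) IsIntegralAt.one)

include hcδ hδ hJD in
/-- **`n(t) ∈ H(𝒪_v)`** for integral skew `t` (non-split `v`, `|2|_w = 1`). [cite: GelbartRogawski1991, §3.1 (3.1.3)] -/
theorem nElem_mem_localInt (w : PlacesOver E v) (hw : c • w.1 = w.1) (h2 : ValuativeRel.valuation (w.1.adicCompletion E) 2 = 1)
    {t : Matrix (Fin n) (Fin n) (LocalRing E v)} (ht : (t.map (conjLocal E c v))ᵀ * gramS F E v n T₀ + gramS F E v n T₀ * t = 0)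
    (hti : IsIntegralAt F E v w t) : nElem F E c v n hJD t ht ∈ UnitaryGroup.localInt E c (n + n) JD v := by
  rw [mem_localInt_iff_w F E c hcδ hδ v n w hw]
  refine apply_mem_glInt_of_isIntegralAt F E c v n w _ (isIntegralAt_matA_nElem F E c v n hJD w h2 ht hti) ?_
  rw [nElem_inv]
  exact isIntegralAt_matA_nElem F E c v n hJD w h2 _ hti.neg

include hcδ hδ hJD in
/-- **`w_Δ ∈ H(𝒪_v)`** (`|2|_w = 1`). [cite: GelbartRogawski1991, §3.1 (3.1.3)] -/
theorem weylDelta_mem_localInt (w : PlacesOver E v) (hw : c • w.1 = w.1) (h2 : ValuativeRel.valuation (w.1.adicCompletion E) 2 = 1) :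
    weylDelta F E c v n hJD (T₀ := T₀) ∈ UnitaryGroup.localInt E c (n + n) JD v := by
  have h1 : ∀ i j : Fin n, ValuativeRel.valuation (w.1.adicCompletion E) ((1 : Matrix (Fin n) (Fin n) (LocalRing E v)) i j w) ≤ 1 := by
    intro i j
    by_cases h : i = j
    · subst h; simp
    · simp [Matrix.one_apply_ne h]
  have hi : IsIntegralAt F E v w (matA F E c v n (weylDelta F E c v n hJD (T₀ := T₀))) := by
    rw [weylDelta, matA_ofAdapted]
    exact isIntegralAt_conj F E v n w h2 (IsIntegralAt.fromBlocks IsIntegralAt.zero h1 h1 IsIntegralAt.zero)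
  rw [mem_localInt_iff_w F E c hcδ hδ v n w hw]
  refine apply_mem_glInt_of_isIntegralAt F E c v n w _ hi ?_
  rw [weylDelta_inv]; exact hi

/-! ## §3 The integral big-cell decomposition and the unramified clause -/

include hcδ hδ hd hT₀ hT₀d hJD in
/-- **THE INTEGRAL BIG-CELL DECOMPOSITION INSIDE `H(𝒪_v)`**: for `k ∈ H(𝒪_v)` and an integral `T₀`-skew `y` with
`C' = A_k + y C_k` invertible with integral inverse, `w_Δ n(y) k = p · (w_Δ n(−ν))` with `ν = −C'⁻¹(B_k + yD_k)`
integral skew and `p, n(y), n(−ν) ∈ P_Δ(F_v) ∩ H(𝒪_v)`. [cite: GelbartRogawski1991, §3.1 (3.1.3); Kudla1994, §3] -/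
theorem exists_bigCell_relation (w : PlacesOver E v) (hw : c • w.1 = w.1) (h2 : ValuativeRel.valuation (w.1.adicCompletion E) 2 = 1)
    {k : UnitaryGroup.localPi E c (n + n) JD v} (hk : k ∈ UnitaryGroup.localInt E c (n + n) JD v)
    {y : Matrix (Fin n) (Fin n) (LocalRing E v)} (hy : (y.map (conjLocal E c v))ᵀ * gramS F E v n T₀ + gramS F E v n T₀ * y = 0)
    (hyi : IsIntegralAt F E v w y) (hC' : IsUnit (blkA (matA F E c v n k) + y * blkC (matA F E c v n k)).det)
    (hC'i : IsIntegralAt F E v w (blkA (matA F E c v n k) + y * blkC (matA F E c v n k))⁻¹) :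
    ∃ n' p n₁ : UnitaryGroup.localPi E c (n + n) JD v,
      (n' ∈ UnitaryGroup.localInt E c (n + n) JD v ∧ IsSiegelDelta F E c hcδ hδ hd v n hT₀ hJD n') ∧
      (p ∈ UnitaryGroup.localInt E c (n + n) JD v ∧ IsSiegelDelta F E c hcδ hδ hd v n hT₀ hJD p) ∧
      (n₁ ∈ UnitaryGroup.localInt E c (n + n) JD v ∧ IsSiegelDelta F E c hcδ hδ hd v n hT₀ hJD n₁) ∧
      weylDelta F E c v n hJD * n' * k = p * (weylDelta F E c v n hJD * n₁) := by
  -- names for the adapted blocks of `k`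
  set A := blkA (matA F E c v n k) with hA
  set B := blkB (matA F E c v n k) with hB
  set C := blkC (matA F E c v n k) with hC
  set D := blkD (matA F E c v n k) with hD
  set C' := A + y * C with hC'def
  set D' := B + y * D with hD'def
  -- the element `Y = w_Δ n(y) k` and its blocks
  set n' := nElem F E c v n hJD y hy with hn'
  set Y := weylDelta F E c v n hJD (T₀ := T₀) * n' * k with hY
  have hYad : adapt (matA F E c v n Y) = Matrix.fromBlocks C D C' D' := by
    rw [hY, ← matA_mul, ← matA_mul, adapt_mul, adapt_mul, weylDelta, adapt_matA_ofAdapted, hn', adapt_matA_nElem,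
      adapt_eq (matA F E c v n k), Matrix.fromBlocks_multiply, Matrix.fromBlocks_multiply]
    simp [hC'def, hD'def, hA, hB, hC, hD]
  have hblkY := Matrix.fromBlocks_inj.1 ((adapt_eq (matA F E c v n Y)).symm.trans hYad)
  have hCY : blkC (matA F E c v n Y) = C' := hblkY.2.2.1
  have hDY : blkD (matA F E c v n Y) = D' := hblkY.2.2.2
  -- `ν = −C'⁻¹ D'` is skew (inverse relation for `Y ∈ H`) and integral
  set ν := -(C'⁻¹ * D') with hν
  have hνs : (ν.map (conjLocal E c v))ᵀ * gramS F E v n T₀ + gramS F E v n T₀ * ν = 0 := by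
    have h := rel_inv₂₂ (σ := conjLocal E c v) (isUnit_det_gramS' F E v n hT₀d) (isUnit_det_matA F E c v n Y) (cstar_matA F E c v n hJD Y)
    rw [hCY, hDY] at h
    exact cstar_neg_invMul_skew (isUnit_det_gramS' F E v n hT₀d) hC' h
  have hki : IsIntegralAt F E v w (adapt (matA F E c v n k)) :=
    isIntegralAt_adapt F E v n w h2 (isIntegralAt_matA_of_mem_localInt F E c hcδ hδ v n w hw hk)
  rw [adapt_eq] at hki
  obtain ⟨hAi, hDi, hBi, hCi⟩ := hki.toBlocks
  simp only [Matrix.toBlocks_fromBlocks₁₁, Matrix.toBlocks_fromBlocks₂₂, Matrix.toBlocks_fromBlocks₁₂, Matrix.toBlocks_fromBlocks₂₁] at hAi hDi hBi hCi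
  have hνi : IsIntegralAt F E v w ν := by
    rw [hν]
    exact (hC'i.mul (IsIntegralAt.add hBi (hyi.mul hDi))).neg
  -- the elements `n(−ν)`, `m = n(ν) w_Δ`, `p = Y m`
  set n₁ := nElem F E c v n hJD (-ν) (skew_neg F E c v n hνs) with hn₁
  set m := nElem F E c v n hJD ν hνs * weylDelta F E c v n hJD (T₀ := T₀) with hm
  have hm1 : m * (weylDelta F E c v n hJD * n₁) = 1 := by
    rw [hm, mul_assoc, ← mul_assoc (weylDelta F E c v n hJD), weylDelta_mul_self, one_mul, hn₁, nElem_mul_nElem_neg]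
  set p := Y * m with hp
  have hwI := weylDelta_mem_localInt F E c hcδ hδ v n hJD (T₀ := T₀) w hw h2
  have hn'I : n' ∈ UnitaryGroup.localInt E c (n + n) JD v := nElem_mem_localInt F E c hcδ hδ v n hJD w hw h2 hy hyi
  have hn₁I : n₁ ∈ UnitaryGroup.localInt E c (n + n) JD v := nElem_mem_localInt F E c hcδ hδ v n hJD w hw h2 _ hνi.neg
  have hmI : m ∈ UnitaryGroup.localInt E c (n + n) JD v :=
    Subgroup.mul_mem _ (nElem_mem_localInt F E c hcδ hδ v n hJD w hw h2 hνs hνi) hwI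
  refine ⟨n', p, n₁, ⟨hn'I, isSiegelDelta_nElem F E c hcδ hδ hd v n hT₀ hJD y hy⟩, ⟨?_, ?_⟩,
    ⟨hn₁I, isSiegelDelta_nElem F E c hcδ hδ hd v n hT₀ hJD _ _⟩, ?_⟩
  · exact Subgroup.mul_mem _ (Subgroup.mul_mem _ (Subgroup.mul_mem _ hwI hn'I) hk) hmI
  · -- `C(p) = C' ν + D' = 0`
    rw [isSiegelDelta_iff_blkC_eq_zero, hp, ← matA_mul, blkC_mul, hCY, hDY]
    have hmad : adapt (matA F E c v n m) = Matrix.fromBlocks ν 1 1 0 := by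
      rw [hm, ← matA_mul, adapt_mul, adapt_matA_nElem, weylDelta, adapt_matA_ofAdapted, Matrix.fromBlocks_multiply]
      simp
    have hblkm := Matrix.fromBlocks_inj.1 ((adapt_eq (matA F E c v n m)).symm.trans hmad)
    rw [hblkm.1, hblkm.2.2.1, Matrix.mul_one, hν, Matrix.mul_neg, Matrix.mul_nonsing_inv_cancel_left _ _ hC', neg_add_cancel]
  · rw [hp, mul_assoc Y m, hm1, mul_one]

include hcδ hδ hd hT₀ hT₀d hJD in
/-- **THE UNRAMIFIED CLAUSE, GROUP-THEORETIC FORM** (non-split `v ∤ 2`): if `Φ₀ ≠ 0` is an eigenvector of `ω(w_Δ)`, every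
element of `P_Δ(F_v) ∩ H(𝒪_v)` fixes `Φ₀` under `ω = β⁻¹ · r ∘ ι`, and every `k ∈ H(𝒪_v)` has an integral residue
witness `y`, then `H(𝒪_v)` fixes `Φ₀`. [cite: GelbartRogawski1991, §3.1 (3.1.3) p. 456; MoeglinVignerasWaldspurger1987, Chap. 2 II.10] -/
theorem omega_eq_self_of_residueWitness (w : PlacesOver E v) (hw : c • w.1 = w.1)
    (h2 : ValuativeRel.valuation (w.1.adicCompletion E) 2 = 1)
    (hU : ImplementerUniqueUpToScalar (localSchrodinger F (n + n) (gramD F n T₀) v))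
    (r : ImplementerSection (localSchrodinger F (n + n) (gramD F n T₀) v))
    (β : UnitaryGroup.localPi E c (n + n) JD v → ℂˣ)
    (hβ : ∀ g₁ g₂, β (g₁ * g₂) * r.cocycle hU (iotaD F E c hcδ hδ hd v n hT₀ hJD g₁) (iotaD F E c hcδ hδ hd v n hT₀ hJD g₂) =
      β g₁ * β g₂)
    {Φ₀ : SchwartzBruhat (Fin (n + n) → v.adicCompletion F)} (hΦ₀ : Φ₀ ≠ 0)
    (heig : ∃ s : ℂ, r.omega (iotaD F E c hcδ hδ hd v n hT₀ hJD) β (weylDelta F E c v n hJD) Φ₀ = s • Φ₀)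
    (hpar : ∀ p ∈ UnitaryGroup.localInt E c (n + n) JD v, IsSiegelDelta F E c hcδ hδ hd v n hT₀ hJD p →
      r.omega (iotaD F E c hcδ hδ hd v n hT₀ hJD) β p Φ₀ = Φ₀)
    (hwit : ∀ k ∈ UnitaryGroup.localInt E c (n + n) JD v, ∃ y : Matrix (Fin n) (Fin n) (LocalRing E v),
      (y.map (conjLocal E c v))ᵀ * gramS F E v n T₀ + gramS F E v n T₀ * y = 0 ∧ IsIntegralAt F E v w y ∧
      IsUnit (blkA (matA F E c v n k) + y * blkC (matA F E c v n k)).det ∧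
      IsIntegralAt F E v w (blkA (matA F E c v n k) + y * blkC (matA F E c v n k))⁻¹) :
    ∀ k ∈ UnitaryGroup.localInt E c (n + n) JD v, r.omega (iotaD F E c hcδ hδ hd v n hT₀ hJD) β k Φ₀ = Φ₀ := by
  refine r.omega_apply_eq_self_of_forall_bigCell_relation' hU (iotaD F E c hcδ hδ hd v n hT₀ hJD) hβ hΦ₀
    (UnitaryGroup.localInt E c (n + n) JD v : Set (UnitaryGroup.localPi E c (n + n) JD v)) heig fun k hk => ?_
  obtain ⟨y, hy, hyi, hC', hC'i⟩ := hwit k hk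
  obtain ⟨n', p, n₁, ⟨hn'I, hn'P⟩, ⟨hpI, hpP⟩, ⟨hn₁I, hn₁P⟩, hrel⟩ :=
    exists_bigCell_relation F E c hcδ hδ hd v n hT₀ hT₀d hJD w hw h2 hk hy hyi hC' hC'i
  exact ⟨n', p, n₁, hpar n' hn'I hn'P, hpar p hpI hpP, hpar n₁ hn₁I hn₁P, hrel⟩

/-! ### Build-lane note (ops-buildfix G11b-3 recipe, LEDGER B13-1, 2026-08-21)
`lean -o` (the hub build lane, never `lean`/the gate check) runs Lean 4.32's library-suggestion indexers
(`Lean.LibrarySuggestions.SymbolFrequency` / `SineQuaNon`, from their `exportEntriesFn`) over the statement of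
every local theorem that is not a denied premise; on this family's statements (very large dependent binder
telescopes through the theta-kernel / dual-pair data) that fold runs for tens of minutes to hours and the build
lane kills the job (incident G11b-3, run/shared/lean/ops/buildfix/G11b-3-DOSSIER.md). `isDeniedPremise` skips
`[implicit_reducible]` constants before any fold, and a reducibility status on a *theorem* is inert (Meta never
unfolds `thmInfo`; the kernel ignores the attribute), so the public theorems of this file are tagged
`[implicit_reducible]` purely to keep them out of that index. Only other effect: they are not offered by
`+suggestions` premise selectors. No statement or proof is changed; superseded if the operator lands a
deny-list form (`HarnessLib.PremiseIndex`). -/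
set_option allowUnsafeReducibility true in
attribute [implicit_reducible]
  isIntegralAt_iff IsIntegralAt.mul IsIntegralAt.add IsIntegralAt.neg IsIntegralAt.zero
  IsIntegralAt.one IsIntegralAt.fromBlocks IsIntegralAt.toBlocks IsIntegralAt.submatrix
  IsIntegralAt.smul isIntegralAt_cayR isIntegralAt_cayRinv isIntegralAt_adapt isIntegralAt_conj
  mem_localInt_iff_w apply_mem_glInt_of_isIntegralAt isIntegralAt_matA_of_mem_localInt
  isUnit_det_gramS' skew_neg adapt_matA_nElem isSiegelDelta_nElem nElem_mul_nElem_neg nElem_inv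
  isIntegralAt_matA_nElem nElem_mem_localInt weylDelta_mem_localInt exists_bigCell_relation
  omega_eq_self_of_residueWitness

end Literature.NumberTheory.GelbartRogawski1991.UnitaryDualPair.LocalSplitting

end
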